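import Literature.Analysis.FluidPDE.TorusLinearisedNSGevreyLattice
import HarnessLib

/-!
# The Gevrey balance of the linearised Navier–Stokes equation along a Gevrey background on `T^d`

Analysis/FluidPDE support file (theorems only; no definitions, no named facts), second of three
files (`TorusLinearisedNSGevreyLattice`, `…Balance`, `…Smoothing`) proving the Gevrey-class
smoothing of the LINEARISED Navier–Stokes flow along a uniformly Gevrey background on `T^d`, the
linear twin of `TorusNSGevreyBalance` (Foias–Temam, J. Funct. Anal. 87 (1989), Thm 1.1 /
Lemma 2.1), reusing the Fourier dictionary of `TorusNSGevreyCoefficients`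
(`NSGevrey.norm_mFourierCoeff_convect_le`, `NSGevrey.inner_mFourierCoeff_gradient_eq_zero`) and the
Parseval sums of `TorusNSGevreySums`.

For a jointly smooth solution `(w, q)` of the linearised Navier–Stokes equation
`∂ₜw + (u·∇)w + (w·∇)u = νΔw − ∇q`, `div w = 0`, `∫ w = 0`, along a jointly smooth background `u`
on `[t₀, t₁] × T^d` (clauses as separate hypotheses, as in `TorusLinearisedNSH1Balance`; no
predicate), with truncated weights `e_k(t) = exp((t − t₀) min(|k|, N))`, `a_k = ‖ŵ(t,k)‖`,
partial Gevrey sums `Y_R = ∑_{ball R} e² |k|² a²`, `Z_R = ∑_{ball R} e² |k|⁴ a²` and full sum `Y`: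

* `NSGevrey.linearisedNS_re_inner_mFourierCoeff_timeDerivWithin` — the **modewise energy identity**
  `Re ⟪𝓕(∂ₜw)(k), ŵ(k)⟫ = −4π²ν|k|² ‖ŵ(k)‖² − Re ⟪𝓕((u·∇)w + (w·∇)u)(k), ŵ(k)⟫`
  (the pressure is invisible since `ŵ(k) ⊥ k`);
* `Torus.linearisedNS_gevreyBalance_le` — the **differential inequality**: if the background obeys
  the weighted `ℓ¹` Gevrey bound `∑ₘ e^{σ|m|} (1 + |m|) ‖û(t, m)‖ ≤ A` on the window and
  `t₁ − t₀ ≤ σ`, then the time derivative of `Y_R(t)`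
  (`NSGevrey.hasDerivWithinAt_sum_exp_sq_mul_freqNormSq_mul`) is at most
  `−(5/4)κ Z_R(t) + (2 + 16 C² A²)/κ · Y(t)`, `κ = 4π²ν`, `C = 2π (card d)²`, uniformly in `N`, `R`,
  the window and the solution — LINEAR in `Y` (`NSGevrey.linearisedLatticeBalance_le`).

Integration in time, `R → ∞`, `N → ∞` and the smoothing theorem are in
`TorusLinearisedNSGevreySmoothing`.

Reference: C. Foias, R. Temam, *Gevrey class regularity for the solutions of the Navier–Stokes
equations*, J. Funct. Anal. 87 (1989) 359–369, §2, (2.4)–(2.15). [FoiasTemam1989]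
-/

noncomputable section

open MeasureTheory Set Filter UnitAddTorus Function Finset
open scoped Topology BigOperators InnerProductSpace

namespace Literature.Analysis.FluidPDE

namespace NSGevrey

open Literature.Analysis.FunctionSpaces Literature.Analysis.FunctionSpaces.Torus

variable {d : Type*} [Fintype d] [DecidableEq d]

/-! ### The modewise energy identity of the linearised equation -/

section Energy

variable {S : Set ℝ} {ν : ℝ} {u w : ℝ → UnitAddTorus d → EuclideanSpace ℝ d} {q : ℝ → UnitAddTorus d → ℝ}

/-- **The linearised momentum equation in Fourier variables, paired with the mode**: for a jointly
smooth solution `(w, q)` of `∂ₜw + (u·∇)w + (w·∇)u = νΔw − ∇q` with `div w(t) = 0` along a jointly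
smooth `u` on `S × T^d` and `t ∈ S` (time derivative within `S`),
`Re ⟪𝓕(∂ₜw)(k), ŵ(k)⟫ = −4π²ν|k|² ‖ŵ(k)‖² − (Re ⟪𝓕((u·∇)w)(k), ŵ(k)⟫ + Re ⟪𝓕((w·∇)u)(k), ŵ(k)⟫)`
(`𝓕(Δw)(k) = −4π²|k|² ŵ(k)`; the pressure term vanishes since `ŵ(k) ⊥ k`,
`NSGevrey.inner_mFourierCoeff_gradient_eq_zero`). The linear twin of
`IsClassicalNSSolutionOn.re_inner_mFourierCoeff_timeDerivWithin`. [cite: FoiasTemam1989, §2 (2.4)–(2.6)] -/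
theorem linearisedNS_re_inner_mFourierCoeff_timeDerivWithin (hu : IsSmoothSpaceTimeOn S u)
    (hw : IsSmoothSpaceTimeOn S w) (hq : IsSmoothSpaceTimeOn S q) (hwdiv : ∀ t ∈ S, IsDivFree (w t))
    (hlin : ∀ t ∈ S, ∀ x, timeDerivWithin S w t x + Torus.convect (u t) (w t) x +
      Torus.convect (w t) (u t) x = ν • Torus.laplacian (w t) x - Torus.gradient (q t) x)
    {t : ℝ} (ht : t ∈ S) (k : d → ℤ) :
    (inner ℂ (mFourierCoeff (EuclideanSpace.complexify ∘ timeDerivWithin S w t) k)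
        (mFourierCoeff (EuclideanSpace.complexify ∘ w t) k)).re =
      -(ν * (4 * Real.pi ^ 2 * freqNormSq k)) * ‖mFourierCoeff (EuclideanSpace.complexify ∘ w t) k‖ ^ 2 -
        ((inner ℂ (mFourierCoeff (EuclideanSpace.complexify ∘ Torus.convect (u t) (w t)) k)
            (mFourierCoeff (EuclideanSpace.complexify ∘ w t) k)).re +
          (inner ℂ (mFourierCoeff (EuclideanSpace.complexify ∘ Torus.convect (w t) (u t)) k)
            (mFourierCoeff (EuclideanSpace.complexify ∘ w t) k)).re) := by
  -- adapted from `IsClassicalNSSolutionOn.re_inner_mFourierCoeff_timeDerivWithin` (`TorusNSGevreyCoefficients`)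
  have hut : IsSmooth (u t) := hu.isSmooth_slice ht
  have hwt : IsSmooth (w t) := hw.isSmooth_slice ht
  have hqt : IsSmooth (q t) := hq.isSmooth_slice ht
  have hc1 : IsSmooth (Torus.convect (u t) (w t)) := hut.convect hwt
  have hc2 : IsSmooth (Torus.convect (w t) (u t)) := hwt.convect hut
  have hpoint : ∀ x, timeDerivWithin S w t x = ν • Torus.laplacian (w t) x -
      Torus.convect (u t) (w t) x - Torus.convect (w t) (u t) x - Torus.gradient (q t) x := by
    intro x
    rw [eq_sub_of_add_eq (eq_sub_of_add_eq (hlin t ht x))]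
    abel
  have heq : (EuclideanSpace.complexify ∘ timeDerivWithin S w t) =
      (ν : ℂ) • (EuclideanSpace.complexify ∘ Torus.laplacian (w t)) -
        EuclideanSpace.complexify ∘ Torus.convect (u t) (w t) -
        EuclideanSpace.complexify ∘ Torus.convect (w t) (u t) -
        EuclideanSpace.complexify ∘ Torus.gradient (q t) := by
    funext x
    simp only [Pi.sub_apply, Pi.smul_apply, Function.comp_apply, hpoint x, map_sub,
      LinearIsometry.map_smul, Complex.coe_smul]
  have hi1 : Integrable (EuclideanSpace.complexify ∘ Torus.laplacian (w t)) volume :=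
    integrable_complexify_comp hwt.laplacian.integrable
  have hi2 : Integrable (EuclideanSpace.complexify ∘ Torus.convect (u t) (w t)) volume :=
    integrable_complexify_comp hc1.integrable
  have hi3 : Integrable (EuclideanSpace.complexify ∘ Torus.convect (w t) (u t)) volume :=
    integrable_complexify_comp hc2.integrable
  have hi4 : Integrable (EuclideanSpace.complexify ∘ Torus.gradient (q t)) volume :=
    integrable_complexify_comp hqt.gradient.integrable
  rw [heq, mFourierCoeff_sub (((hi1.smul (ν : ℂ)).sub hi2).sub hi3) hi4,
    mFourierCoeff_sub ((hi1.smul (ν : ℂ)).sub hi2) hi3, mFourierCoeff_sub (hi1.smul (ν : ℂ)) hi2,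
    mFourierCoeff_const_smul, mFourierCoeff_complexify_laplacian hwt]
  simp only [inner_sub_left, inner_smul_left, inner_neg_left, Complex.conj_ofReal,
    inner_mFourierCoeff_gradient_eq_zero hqt hwt (hwdiv t ht), sub_zero, Complex.sub_re]
  set v : EuclideanSpace ℂ d := mFourierCoeff (EuclideanSpace.complexify ∘ w t) k with hv
  have hself : (inner ℂ v v).re = ‖v‖ ^ 2 := by
    have := inner_self_eq_norm_sq (𝕜 := ℂ) v
    rwa [RCLike.re_to_complex] at this
  have hre : ((ν : ℂ) * -(((4 * Real.pi ^ 2 * freqNormSq k : ℝ) : ℂ) * inner ℂ v v)).re =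
      -(ν * (4 * Real.pi ^ 2 * freqNormSq k)) * ‖v‖ ^ 2 := by
    rw [← hself, show (ν : ℂ) * -(((4 * Real.pi ^ 2 * freqNormSq k : ℝ) : ℂ) * inner ℂ v v) =
      ((-(ν * (4 * Real.pi ^ 2 * freqNormSq k)) : ℝ) : ℂ) * inner ℂ v v by push_cast; ring,
      Complex.re_ofReal_mul]
  rw [hre]
  ring

end Energy

/-! ### The balance along a linearised solution -/

section Solution

variable {ν : ℝ} {t₀ t₁ σ A : ℝ} {u w : ℝ → UnitAddTorus d → EuclideanSpace ℝ d} {q : ℝ → UnitAddTorus d → ℝ}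

/-- **The Gevrey balance along a solution of the linearised Navier–Stokes equation** (the
differential inequality, truncated weights `e_k(t) = exp((t − t₀) min(|k|, N))`, `κ = 4π²ν`,
`C = 2π (card d)²`). Let `(w, q)` solve the linearised equation along a jointly smooth `u` on
`[t₀, t₁] × T^d` with divergence-free mean-zero slices, and let the background obey
the weighted `ℓ¹` Gevrey bound `∑ₘ e^{σ|m|}(1 + |m|) ‖û(t, m)‖ ≤ A` on the window, `t₁ − t₀ ≤ σ`.
Then for all `N ≥ 0`, `R`, `t ∈ [t₀, t₁]` the time derivative of the partial truncated Gevrey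
enstrophy `Y_R(t)` of `w` (`NSGevrey.hasDerivWithinAt_sum_exp_sq_mul_freqNormSq_mul`) is at most
`−(5/4)κ Z_R(t) + (2 + 16 C² A²)/κ · Y(t)` — LINEAR in the full truncated Gevrey enstrophy `Y`
(the lattice theorem via the modewise identity and the convolution bounds for `(u·∇)w`, `(w·∇)u`).
[cite: FoiasTemam1989, Lemma 2.1 and (2.7)–(2.15)] -/
theorem _root_.Literature.Analysis.FluidPDE.Torus.linearisedNS_gevreyBalance_le (hν : 0 < ν)
    (hu : IsSmoothSpaceTimeOn (Icc t₀ t₁) u) (hw : IsSmoothSpaceTimeOn (Icc t₀ t₁) w)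
    (hq : IsSmoothSpaceTimeOn (Icc t₀ t₁) q) (hwdiv : ∀ t ∈ Icc t₀ t₁, IsDivFree (w t))
    (hzm : ∀ t ∈ Icc t₀ t₁, HasZeroMean (w t))
    (hlin : ∀ t ∈ Icc t₀ t₁, ∀ x, timeDerivWithin (Icc t₀ t₁) w t x + Torus.convect (u t) (w t) x +
      Torus.convect (w t) (u t) x = ν • Torus.laplacian (w t) x - Torus.gradient (q t) x)
    (hσ : t₁ - t₀ ≤ σ)
    (hgev : ∀ t ∈ Icc t₀ t₁, (Summable fun m : d → ℤ => Real.exp (σ * Real.sqrt (freqNormSq m)) *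
        ((1 + Real.sqrt (freqNormSq m)) * ‖mFourierCoeff (EuclideanSpace.complexify ∘ u t) m‖)) ∧
      ∑' m : d → ℤ, Real.exp (σ * Real.sqrt (freqNormSq m)) *
        ((1 + Real.sqrt (freqNormSq m)) * ‖mFourierCoeff (EuclideanSpace.complexify ∘ u t) m‖) ≤ A)
    {N : ℝ} (R : ℕ) {t : ℝ} (hN : 0 ≤ N) (ht : t ∈ Icc t₀ t₁) :
    ∑ k ∈ freqBall R, (2 * min (Real.sqrt (freqNormSq k)) N *
          Real.exp ((t - t₀) * min (Real.sqrt (freqNormSq k)) N) ^ 2 *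
            (freqNormSq k * ‖mFourierCoeff (EuclideanSpace.complexify ∘ w t) k‖ ^ 2) +
        Real.exp ((t - t₀) * min (Real.sqrt (freqNormSq k)) N) ^ 2 * (freqNormSq k *
          (2 * (inner ℂ (mFourierCoeff (EuclideanSpace.complexify ∘ timeDerivWithin (Icc t₀ t₁) w t) k)
            (mFourierCoeff (EuclideanSpace.complexify ∘ w t) k)).re))) ≤
      -(5 / 4 * (4 * Real.pi ^ 2 * ν)) * ∑ k ∈ freqBall R,
          Real.exp ((t - t₀) * min (Real.sqrt (freqNormSq k)) N) ^ 2 *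
            (freqNormSq k ^ 2 * ‖mFourierCoeff (EuclideanSpace.complexify ∘ w t) k‖ ^ 2) +
        (2 + 16 * (2 * Real.pi * (Fintype.card d : ℝ) ^ 2) ^ 2 * A ^ 2) / (4 * Real.pi ^ 2 * ν) *
          ∑' k, Real.exp ((t - t₀) * min (Real.sqrt (freqNormSq k)) N) ^ 2 *
            (freqNormSq k * ‖mFourierCoeff (EuclideanSpace.complexify ∘ w t) k‖ ^ 2) := by
  have hκ : 0 < 4 * Real.pi ^ 2 * ν := by positivity
  have hC : (0 : ℝ) ≤ 2 * Real.pi * (Fintype.card d : ℝ) ^ 2 := by positivity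
  have hut : IsSmooth (u t) := hu.isSmooth_slice ht
  have hwt : IsSmooth (w t) := hw.isSmooth_slice ht
  -- the modewise identity, in the lattice form `-(κ x) a² - r`
  have hmode : ∀ k : d → ℤ,
      (inner ℂ (mFourierCoeff (EuclideanSpace.complexify ∘ timeDerivWithin (Icc t₀ t₁) w t) k)
        (mFourierCoeff (EuclideanSpace.complexify ∘ w t) k)).re =
      -((4 * Real.pi ^ 2 * ν) * freqNormSq k) * ‖mFourierCoeff (EuclideanSpace.complexify ∘ w t) k‖ ^ 2 -
        ((inner ℂ (mFourierCoeff (EuclideanSpace.complexify ∘ Torus.convect (u t) (w t)) k)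
            (mFourierCoeff (EuclideanSpace.complexify ∘ w t) k)).re +
          (inner ℂ (mFourierCoeff (EuclideanSpace.complexify ∘ Torus.convect (w t) (u t)) k)
            (mFourierCoeff (EuclideanSpace.complexify ∘ w t) k)).re) := fun k => by
    rw [linearisedNS_re_inner_mFourierCoeff_timeDerivWithin hu hw hq hwdiv hlin ht k]
    ring
  simp only [hmode]
  refine linearisedLatticeBalance_le hκ hC R (fun k => norm_nonneg _) ?_ ?_ (fun k => norm_nonneg _)
    (hgev t ht).1 (hgev t ht).2 (sub_nonneg.2 ht.1) ((sub_le_sub_right ht.2 _).trans hσ) hN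
    (fun k => add_le_add (norm_mFourierCoeff_convect_le hut hwt k) (norm_mFourierCoeff_convect_le hwt hut k))
    (fun k => ?_)
  · rw [mFourierCoeff_complexify_zero_of_hasZeroMean hwt.integrable (hzm t ht), norm_zero]
  · have h1 := (summable_weight_mul_freqNormSq_sq_mul hwt (w := fun _ => (1 : ℝ)) (W := 1)
      (fun _ => zero_le_one) (fun _ => le_rfl)).1
    simpa only [one_mul] using h1
  · rw [add_mul]
    exact (abs_add_le _ _).trans (add_le_add ((Complex.abs_re_le_norm _).trans (norm_inner_le_norm _ _))
      ((Complex.abs_re_le_norm _).trans (norm_inner_le_norm _ _)))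

end Solution

end NSGevrey

end Literature.Analysis.FluidPDE
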